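import Mathlib
import HarnessLib
import Summits.HubbardSuperconductivity.HubbardSuperconductivity.Theorems.KLProgrammeKLRegimeTwoVolumeSrcSectorScaleSuccWt
import Summits.HubbardSuperconductivity.HubbardSuperconductivity.Theorems.KLProgrammeKLRegimeTwoVolumeTransferTailsWt
import Literature.MathematicalPhysics.QuantumLattice.GrassmannWeightedEffectiveActionBoundDB

/-!
# Route `KLProgramme` — crux K3, VL child `KLRegimeVolumeLimitV17F2` (stmt-HubbardSuperconductivity-20440), blueprint v5 M3d-min: ONE SCALE OF THE TWO-VOLUME
# INDUCTION ON THE DOUBLED SECTOR-FIELD LEGS FROM THE MINIMAL ONE-VOLUME CURRENCY (seat hubbard-kl-k3c4-p1 g12; `--supports` 20440)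

`srcSector_sum_norm_kernel_twoVolume_scaleSucc_wt_le` (M3d-wt, p587285) reads ≈ 60 data.  This file derives all of them from the MINIMAL one-volume currency the
engine exports (blueprint v5 §4, M3b): per volume the Gram constant and the Λ-scaled weighted rows/columns `Σ‖C‖(1+Λ·tnorm) ≤ αW` of the sector covariance;
the Λ_T-scaled weighted rows/columns `≤ cW` of the fine block substitution `T⁺_{L″}` and its block covariance; the weighted pinned profile `N𝒲` of the coarse
previous action at its own rate `Λ₁` (raw degree); the weighted profiles `NV`, `NW′` of the two re-analysed inputs at rate `Λ` (the engine's SUB-DIAGONAL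
read-outs, both volumes); the scale-`j` two-volume data `Ej/NDj`; field radii `ρ₀ ρf ρ₂ ρ′` with their smallness conditions; a region schedule
`r ≤ RN ≤ RZ`, `r ≤ RF`, `r + RZ ≤ R`.  Derived inside: entry sups / plain rows / first moments (`…DataKitWt`), far and fibre tails `T = Te := αW′/(1+Λ(R+1))`,
the nine transfer data with `aT := cW`, `τT := cW/(1+Λ_T(r+1))` (`…TransferTailsWt`), the plain and far profiles of `𝒲` (`Nj := N𝒲`,
`Nfarj := N𝒲/(1+Λ₁(RZ−RN+1))`), and the coarse OUTPUT weighted profile `Nw m′ = ρ₀^{−2m′}·e·normV(κ,ρ₀,NV)/(1−θ₀)` together with the coarse unit partition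
function by ONE weighted determinant-bounded step (`GrassmannWeightedEffectiveActionBoundDB.sum_wt_norm_kernel_effAction_le_of_gramBounded`, used once — no
iteration).  **`srcSector_sum_norm_kernel_twoVolume_scaleSucc_min_le`**.  Sorry-free; no definition.
References: BGM 2006 §2.7, §2.9, §3 (3.2)–(3.8); Salmhofer 1999 §4.2.4, (2.102)–(2.106).
-/

noncomputable section

namespace Summit.HubbardSuperconductivity.HubbardSuperconductivity.Theorems.TwoVolumeDefect

set_option linter.dupNamespace false -- summit = problem name (single-conjunct summit), D-0017

open Finset Literature.MathematicalPhysics.QuantumLattice GrassmannAlgebra Literature.Probability.LatticeModels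
  Literature.Probability.LatticeModels.BattleFederbush
open Summit.HubbardSuperconductivity.HubbardSuperconductivity.Theorems.TwoPointAssembly

set_option maxHeartbeats 400000 in -- one 120-binder instantiation of M3d-wt plus the derived data
/-- **ONE SCALE OF THE TWO-VOLUME INDUCTION ON THE DOUBLED LEGS, FROM THE MINIMAL ONE-VOLUME CURRENCY** (see the module docstring).
[folklore; BGM 2006 §2.7, §2.9, §3; Salmhofer 1999 (2.102)–(2.106)] -/
theorem srcSector_sum_norm_kernel_twoVolume_scaleSucc_min_le {b L Lf M N N₁ : ℕ} [NeZero Lf] [NeZero L] [NeZero M]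
    [LinearOrder ((SpaceTimeIdx Lf M × SectorLeg N) × Fin 2)]
    (hLf : Lf = b * L) {β : ℝ} (hβ : β ≠ 0) {Λ : ℝ} (hΛ : 0 < Λ)
    -- the block structures of the scale-`j+1` and scale-`j` legs and their doublings
    (e : (SpaceTimeIdx Lf M × SectorLeg N) ≃ (Fin 2 → Fin b) × (SpaceTimeIdx L M × SectorLeg N))
    (he1 : ∀ X' i, ((e X').1 i : ℕ) = (X'.1.2 i).val / L) (he2 : ∀ X', (e X').2 = ((X'.1.1, fun i => (((X'.1.2 i).val : ℕ) : ZMod L)), X'.2))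
    (ed : ((SpaceTimeIdx Lf M × SectorLeg N) × Fin 2) ≃ (Fin 2 → Fin b) × ((SpaceTimeIdx L M × SectorLeg N) × Fin 2)) (hed : ∀ x s, ed (x, s) = ((e x).1, ((e x).2, s)))
    (e₁ : (SpaceTimeIdx Lf M × SectorLeg N₁) ≃ (Fin 2 → Fin b) × (SpaceTimeIdx L M × SectorLeg N₁))
    (he₁1 : ∀ X' i, ((e₁ X').1 i : ℕ) = (X'.1.2 i).val / L) (he₁2 : ∀ X', (e₁ X').2 = ((X'.1.1, fun i => (((X'.1.2 i).val : ℕ) : ZMod L)), X'.2))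
    (ed₁ : ((SpaceTimeIdx Lf M × SectorLeg N₁) × Fin 2) ≃ (Fin 2 → Fin b) × ((SpaceTimeIdx L M × SectorLeg N₁) × Fin 2)) (hed₁ : ∀ x s, ed₁ (x, s) = ((e₁ x).1, ((e₁ x).2, s)))
    -- the sampled fat family and symbol of the STEP covariances, the spectator lifts
    (𝔣t : Fin N → MatsubaraIdx M → (Fin 2 → ℝ) → ℂ) (Φ : MatsubaraIdx M → Fin 2 → (Fin 2 → ℝ) → ℂ)
    (FtL : Fin N → FreqMomentum L M → ℂ) (FtLf : Fin N → FreqMomentum Lf M → ℂ)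
    (hFtL : ∀ ω i q, FtL ω (i, q) = 𝔣t ω i (latticeMomentum L q)) (hFtLf : ∀ ω i q, FtLf ω (i, q) = 𝔣t ω i (latticeMomentum Lf q))
    (pL : FreqMomentum L M × Fin 2 → ℂ) (pLf : FreqMomentum Lf M × Fin 2 → ℂ)
    (hpL : ∀ i q σ, pL ((i, q), σ) = ((β * (L : ℝ) ^ 2 : ℝ) : ℂ) * Φ i σ (latticeMomentum L q))
    (hpLf : ∀ i q σ, pLf ((i, q), σ) = ((β * (Lf : ℝ) ^ 2 : ℝ) : ℂ) * Φ i σ (latticeMomentum Lf q))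
    (CL : Matrix (SpaceTimeIdx L M × SectorLeg N) (SpaceTimeIdx L M × SectorLeg N) ℂ)
    (hCL : CL = (sectorSubMatrix L M β FtL).transpose * normalCovariance L M pL * sectorSubMatrix L M β FtL)
    (CLf : Matrix (SpaceTimeIdx Lf M × SectorLeg N) (SpaceTimeIdx Lf M × SectorLeg N) ℂ)
    (hCLf : CLf = (sectorSubMatrix Lf M β FtLf).transpose * normalCovariance Lf M pLf * sectorSubMatrix Lf M β FtLf)
    (Cd : Matrix ((SpaceTimeIdx L M × SectorLeg N) × Fin 2) ((SpaceTimeIdx L M × SectorLeg N) × Fin 2) ℂ) (hCd : ∀ p q, Cd p q = if p.2 = 0 ∧ q.2 = 0 then CL p.1 q.1 else 0)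
    (Cd' : Matrix ((SpaceTimeIdx Lf M × SectorLeg N) × Fin 2) ((SpaceTimeIdx Lf M × SectorLeg N) × Fin 2) ℂ) (hCd' : ∀ p q, Cd' p q = if p.2 = 0 ∧ q.2 = 0 then CLf p.1 q.1 else 0)
    -- the sampled re-sectorisations `T_V = ε • E_V(F′)·S_V(F̃₁)`, the source relabellings `J_V`, the block substitutions `T⁺_V`
    (𝔣' : Fin N → MatsubaraIdx M → (Fin 2 → ℝ) → ℂ) (𝔣₁ : Fin N₁ → MatsubaraIdx M → (Fin 2 → ℝ) → ℂ)
    (F'L : Fin N → FreqMomentum L M → ℂ) (F'Lf : Fin N → FreqMomentum Lf M → ℂ)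
    (hF'L : ∀ ω i q, F'L ω (i, q) = 𝔣' ω i (latticeMomentum L q)) (hF'Lf : ∀ ω i q, F'Lf ω (i, q) = 𝔣' ω i (latticeMomentum Lf q))
    (F₁L : Fin N₁ → FreqMomentum L M → ℂ) (F₁Lf : Fin N₁ → FreqMomentum Lf M → ℂ)
    (hF₁L : ∀ ω i q, F₁L ω (i, q) = 𝔣₁ ω i (latticeMomentum L q)) (hF₁Lf : ∀ ω i q, F₁Lf ω (i, q) = 𝔣₁ ω i (latticeMomentum Lf q))
    (Tc : Matrix (SpaceTimeIdx L M × SectorLeg N) (SpaceTimeIdx L M × SectorLeg N₁) ℂ)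
    (hTc : Tc = ((imagTimeWeight β M : ℝ) : ℂ) • (sectorAnalysisMatrix L M β F'L * sectorSubMatrix L M β F₁L))
    (Tf : Matrix (SpaceTimeIdx Lf M × SectorLeg N) (SpaceTimeIdx Lf M × SectorLeg N₁) ℂ)
    (hTf : Tf = ((imagTimeWeight β M : ℝ) : ℂ) • (sectorAnalysisMatrix Lf M β F'Lf * sectorSubMatrix Lf M β F₁Lf))
    (Jc : Matrix (SpaceTimeIdx L M × SectorLeg N) (SpaceTimeIdx L M × SectorLeg N₁) ℂ) (Jf : Matrix (SpaceTimeIdx Lf M × SectorLeg N) (SpaceTimeIdx Lf M × SectorLeg N₁) ℂ)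
    (hPJ : ∀ (X' : (SpaceTimeIdx Lf M × SectorLeg N)) (Y : (SpaceTimeIdx L M × SectorLeg N₁)),
      ∑ Y'' ∈ univ.filter (fun Y'' : (SpaceTimeIdx Lf M × SectorLeg N₁) => (e₁ Y'').2 = Y), Jf X' Y'' = Jc (e X').2 Y)
    (Tpc : Matrix ((SpaceTimeIdx L M × SectorLeg N) × Fin 2) ((SpaceTimeIdx L M × SectorLeg N₁) × Fin 2) ℂ)
    (hTpc : ∀ p' p, Tpc p' p = if p'.2 = 0 ∧ p.2 = 0 then Tc p'.1 p.1 else if p'.2 = 1 ∧ p.2 = 1 then Jc p'.1 p.1 else 0)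
    (Tpf : Matrix ((SpaceTimeIdx Lf M × SectorLeg N) × Fin 2) ((SpaceTimeIdx Lf M × SectorLeg N₁) × Fin 2) ℂ)
    (hTpf : ∀ p' p, Tpf p' p = if p'.2 = 0 ∧ p.2 = 0 then Tf p'.1 p.1 else if p'.2 = 1 ∧ p.2 = 1 then Jf p'.1 p.1 else 0)
    -- the region schedule: zone depth `R`, extra pin depth `R′`, transfer radii `RN ≤ RZ`, `RF`, tail radius `r` (`r ≤ RN`, `r ≤ RF`, `r + RZ ≤ R`); the pin
    (R R' RN RZ RF r : ℕ) (hNZ : RN ≤ RZ) (hrN : r ≤ RN) (hrF : r ≤ RF) (hrZR : r + RZ ≤ R)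
    (w : ((SpaceTimeIdx Lf M × SectorLeg N) × Fin 2)) (hw : ∀ j, R + R' ≤ (w.1.1.2 j).val % L ∧ (w.1.1.2 j).val % L + (R + R') < L)
    -- ONE-VOLUME COVARIANCE DATA (Gram constant, Λ-scaled weighted rows/columns), both volumes
    {κ κ' : ℝ} (hκ : 0 < κ) (hκ' : 0 < κ') (hGB : IsGramBoundedR CL κ) (hGB' : IsGramBoundedR CLf κ')
    {αW αW' : ℝ} (hαW : 0 < αW) (hαW' : 0 < αW')
    (hrowW : ∀ X, ∑ Y, ‖CL X Y‖ * (1 + Λ * (Torus.tnorm (X.1.2 - Y.1.2) : ℝ)) ≤ αW)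
    (hcolW : ∀ Y, ∑ X, ‖CL X Y‖ * (1 + Λ * (Torus.tnorm (X.1.2 - Y.1.2) : ℝ)) ≤ αW)
    (hrowW' : ∀ X', ∑ Y', ‖CLf X' Y'‖ * (1 + Λ * (Torus.tnorm (X'.1.2 - Y'.1.2) : ℝ)) ≤ αW')
    (hcolW' : ∀ Y', ∑ X', ‖CLf X' Y'‖ * (1 + Λ * (Torus.tnorm (X'.1.2 - Y'.1.2) : ℝ)) ≤ αW')
    -- ONE-VOLUME TRANSFER DATA of `T⁺_{L″}`: Λ_T-scaled weighted rows/columns and block covariance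
    {ΛT cW : ℝ} (hΛT : 0 ≤ ΛT) (hcW : 0 ≤ cW)
    (hrowT : ∀ x : ((SpaceTimeIdx Lf M × SectorLeg N) × Fin 2), ∑ y', ‖Tpf x y'‖ * (1 + ΛT * (Torus.tnorm (x.1.1.2 - y'.1.1.2) : ℝ)) ≤ cW)
    (hcolT : ∀ y' : ((SpaceTimeIdx Lf M × SectorLeg N₁) × Fin 2), ∑ x, ‖Tpf x y'‖ * (1 + ΛT * (Torus.tnorm (x.1.1.2 - y'.1.1.2) : ℝ)) ≤ cW)
    (hcovT : ∀ (δ β' β : Fin 2 → Fin b) (xbar : ((SpaceTimeIdx L M × SectorLeg N) × Fin 2)) (y : ((SpaceTimeIdx L M × SectorLeg N₁) × Fin 2)),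
      ‖Tpf (ed.symm (β' + δ, xbar)) (ed₁.symm (β + δ, y))‖ = ‖Tpf (ed.symm (β', xbar)) (ed₁.symm (β, y))‖)
    -- the two DOUBLED scale-`j` actions (parity, no constant part) and their ONE-VOLUME profiles: the coarse previous action at its own rate `Λ₁` (raw degree),
    -- the two re-analysed inputs at rate `Λ` (the engine's sub-diagonal read-outs), the coarse step's field radius `ρ₀` and its smallness
    (𝒲 : GrassmannAlgebra ℂ ((SpaceTimeIdx L M × SectorLeg N₁) × Fin 2)) (h𝒲e : 𝒲 ∈ evenOdd ℂ 0) (h𝒲0 : constPart ℂ 𝒲 = 0)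
    (𝒲' : GrassmannAlgebra ℂ ((SpaceTimeIdx Lf M × SectorLeg N₁) × Fin 2)) (h𝒲'e : 𝒲' ∈ evenOdd ℂ 0) (h𝒲'0 : constPart ℂ 𝒲' = 0)
    {Λ₁ : ℝ} (hΛ₁ : 0 ≤ Λ₁) (N𝒲 : ℕ → ℝ) (hN𝒲0 : ∀ k, 0 ≤ N𝒲 k)
    (hN𝒲 : ∀ (k : ℕ) (p : Fin k) (y : ((SpaceTimeIdx L M × SectorLeg N₁) × Fin 2)),
      ∑ Y ∈ univ.filter (fun Y : Fin k → ((SpaceTimeIdx L M × SectorLeg N₁) × Fin 2) => Y p = y),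
        ‖kernel ℂ 𝒲 k Y‖ * (1 + labelDiam (fun Y₁ Y₂ : ((SpaceTimeIdx L M × SectorLeg N₁) × Fin 2) => Λ₁ * (Torus.tnorm (Y₁.1.1.2 - Y₂.1.1.2) : ℝ)) (univ.image Y)) ≤ N𝒲 k)
    (NV NW' : ℕ → ℝ) (hNV0 : ∀ m', 0 ≤ NV m') (hNW'0 : ∀ m', 0 ≤ NW' m')
    (hNV : ∀ m' (j : Fin (2 * m')) (x : ((SpaceTimeIdx L M × SectorLeg N) × Fin 2)),
      ∑ Y ∈ univ.filter (fun Y : Fin (2 * m') → ((SpaceTimeIdx L M × SectorLeg N) × Fin 2) => Y j = x),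
        ‖kernel ℂ (ExteriorAlgebra.map (Matrix.toLin' Tpc) 𝒲) (2 * m') Y‖ *
          (1 + labelDiam (fun Y₁ Y₂ : ((SpaceTimeIdx L M × SectorLeg N) × Fin 2) => Λ * (Torus.tnorm (Y₁.1.1.2 - Y₂.1.1.2) : ℝ)) (univ.image Y)) ≤ NV m')
    (hNW' : ∀ m' (j : Fin (2 * m')) (x : ((SpaceTimeIdx Lf M × SectorLeg N) × Fin 2)),
      ∑ Y ∈ univ.filter (fun Y : Fin (2 * m') → ((SpaceTimeIdx Lf M × SectorLeg N) × Fin 2) => Y j = x),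
        ‖kernel ℂ (ExteriorAlgebra.map (Matrix.toLin' Tpf) 𝒲') (2 * m') Y‖ *
          (1 + labelDiam (fun Y₁ Y₂ : ((SpaceTimeIdx Lf M × SectorLeg N) × Fin 2) => Λ * (Torus.tnorm (Y₁.1.1.2 - Y₂.1.1.2) : ℝ)) (univ.image Y)) ≤ NW' m')
    {ρ₀ : ℝ} (hρ₀ : 0 < ρ₀) (hθ₀ : Real.exp 1 * αW * normV ((SpaceTimeIdx L M × SectorLeg N) × Fin 2) κ ρ₀ NV / κ ^ 2 < 1)
    (Nw : ℕ → ℝ) (hNwdef : ∀ m', Nw m' = ρ₀⁻¹ ^ (2 * m') * (Real.exp 1 * normV ((SpaceTimeIdx L M × SectorLeg N) × Fin 2) κ ρ₀ NV) / (1 - Real.exp 1 * αW * normV ((SpaceTimeIdx L M × SectorLeg N) × Fin 2) κ ρ₀ NV / κ ^ 2))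
    -- the other field radii and the smallness conditions of the two-volume step (α = m₁ = s := αW, primed := αW′)
    {ρf : ℝ} (hρf : 0 < ρf)
    (hθw : Real.exp 1 * (αW' + αW + (αW' + αW)) * normV ((SpaceTimeIdx Lf M × SectorLeg N) × Fin 2) (κ' + κ) ρf Nw / (κ' + κ) ^ 2 < 1)
    {ρ₂ : ℝ} (hρ₂ : 0 < ρ₂)
    (hθ₂ : Real.exp 1 * (αW' + αW + (αW' + αW)) * normV ((SpaceTimeIdx Lf M × SectorLeg N) × Fin 2) (κ' + κ + (κ' + κ + (κ' + κ))) ρ₂ Nw /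
      (κ' + κ + (κ' + κ + (κ' + κ))) ^ 2 < 1)
    -- the scale-`j` TWO-VOLUME data (induction hypothesis) in block-reduced form, the transfer majorant `Ein` with `aT := cW`, `τT := cW/(1+Λ_T(r+1))`,
    -- `Nj := N𝒲`, `Nfarj := N𝒲/(1+Λ₁(RZ−RN+1))`, its cap, and the two smallness conditions of the interaction bracket
    (Ej NDj : ℕ → ℝ) (hEj0 : ∀ k, 0 ≤ Ej k) (hNDj0 : ∀ k, 0 ≤ NDj k)
    (hEj : ∀ x : ((SpaceTimeIdx Lf M × SectorLeg N) × Fin 2), (∀ j, R ≤ (x.1.1.2 j).val % L ∧ (x.1.1.2 j).val % L + R < L) →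
      ∀ (k : ℕ) (p : Fin k) (y' : ((SpaceTimeIdx Lf M × SectorLeg N₁) × Fin 2)), Torus.tnorm (x.1.1.2 - y'.1.1.2) ≤ RF →
        ∑ Y' ∈ univ.filter (fun Y' : Fin k → ((SpaceTimeIdx Lf M × SectorLeg N₁) × Fin 2) => Y' p = y'),
          ‖kernel ℂ 𝒲' k Y' - (if ∀ i, (ed₁ (Y' i)).1 = (ed₁ (Y' p)).1 then kernel ℂ 𝒲 k (fun i => (ed₁ (Y' i)).2) else 0)‖ ≤ Ej k)
    (hNDj : ∀ (k : ℕ) (p : Fin k) (y' : ((SpaceTimeIdx Lf M × SectorLeg N₁) × Fin 2)),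
      ∑ Y' ∈ univ.filter (fun Y' : Fin k → ((SpaceTimeIdx Lf M × SectorLeg N₁) × Fin 2) => Y' p = y'),
        ‖kernel ℂ 𝒲' k Y' - (if ∀ i, (ed₁ (Y' i)).1 = (ed₁ (Y' p)).1 then kernel ℂ 𝒲 k (fun i => (ed₁ (Y' i)).2) else 0)‖ ≤ NDj k)
    (Ein : ℕ → ℝ) (hEin0 : ∀ m', 0 ≤ Ein m')
    (hEin : ∀ m', 1 ≤ m' → ∀ n : ℕ, 2 * m' = n + 1 →
      cW ^ n * (cW * Ej (n + 1) + cW / (1 + ΛT * ((r : ℝ) + 1)) * NDj (n + 1)) +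
        (2 * cW ^ n * (cW / (1 + ΛT * ((r : ℝ) + 1))) * N𝒲 (n + 1) +
          n * cW ^ n * (5 * (cW / (1 + ΛT * ((r : ℝ) + 1))) * N𝒲 (n + 1) + 2 * cW * ((1 + Λ₁ * (((RZ - RN : ℕ) : ℝ) + 1))⁻¹ * N𝒲 (n + 1)))) ≤ Ein m')
    {ρ' : ℝ} (hρ' : 0 < ρ') {νEbar : ℝ} (hνE : normV ((SpaceTimeIdx Lf M × SectorLeg N) × Fin 2) κ' ρ' Ein ≤ νEbar)
    (hbar : Real.exp 1 * αW' * (normV ((SpaceTimeIdx Lf M × SectorLeg N) × Fin 2) κ' ρ' (fun m' => NV m' + (NW' m' + NV m')) + νEbar) / κ' ^ 2 < 1)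
    (hθ₂' : Real.exp 1 * αW' * (normV ((SpaceTimeIdx Lf M × SectorLeg N) × Fin 2) κ' ρ' NV + normV ((SpaceTimeIdx Lf M × SectorLeg N) × Fin 2) κ' ρ' (fun m' => NW' m' + NV m')) / κ' ^ 2 < 1)
    (n : ℕ) (p : Fin (n + 1)) :
    ∑ X ∈ univ.filter (fun X : Fin (n + 1) → ((SpaceTimeIdx Lf M × SectorLeg N) × Fin 2) => X p = w),
        ‖kernel ℂ (effAction ℂ Cd' (ExteriorAlgebra.map (Matrix.toLin' Tpf) 𝒲')) (n + 1) X -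
          (if ∀ i, (ed (X i)).1 = (ed (X p)).1 then
            kernel ℂ (effAction ℂ Cd (ExteriorAlgebra.map (Matrix.toLin' Tpc) 𝒲)) (n + 1) (fun i => (ed (X i)).2) else 0)‖ ≤
      (ρ'⁻¹ ^ (n + 1) * Real.exp 1 / (1 - Real.exp 1 * αW' * (normV ((SpaceTimeIdx Lf M × SectorLeg N) × Fin 2) κ' ρ' (fun m' => NV m' + (NW' m' + NV m')) + νEbar) / κ' ^ 2) ^ 2) * normV ((SpaceTimeIdx Lf M × SectorLeg N) × Fin 2) κ' ρ' Ein +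
        (ρ'⁻¹ ^ (n + 1) * (Real.exp 1 * normV ((SpaceTimeIdx Lf M × SectorLeg N) × Fin 2) κ' ρ' (fun m' => NW' m' + NV m')) / (1 - Real.exp 1 * αW' * (normV ((SpaceTimeIdx Lf M × SectorLeg N) × Fin 2) κ' ρ' NV + normV ((SpaceTimeIdx Lf M × SectorLeg N) × Fin 2) κ' ρ' (fun m' => NW' m' + NV m')) / κ' ^ 2) ^ 2) * (1 + Λ * ((R' : ℝ) + 1))⁻¹ +
        ((((n + 1 + 1) * (n + 1 + 2) : ℕ) : ℝ) / 2 *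
            (ρ₂⁻¹ ^ (n + 3) * (Real.exp 1 * normV ((SpaceTimeIdx Lf M × SectorLeg N) × Fin 2) (κ' + κ + (κ' + κ + (κ' + κ))) ρ₂ Nw) / (1 - Real.exp 1 * (αW' + αW + (αW' + αW)) * normV ((SpaceTimeIdx Lf M × SectorLeg N) × Fin 2) (κ' + κ + (κ' + κ + (κ' + κ))) ρ₂ Nw / (κ' + κ + (κ' + κ + (κ' + κ))) ^ 2))) * (αW' / (1 + Λ * ((R : ℝ) + 1))) +
        (‖(2 : ℂ)⁻¹‖ * ∑ a ∈ range (n + 2), ∑ b ∈ range (n + 2),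
            (if a + b = n + 1 then (((a + 1) * (b + 1) : ℕ) : ℝ) *
              (4 * (ρ₂⁻¹ ^ (a + 1) * (Real.exp 1 * normV ((SpaceTimeIdx Lf M × SectorLeg N) × Fin 2) (κ' + κ + (κ' + κ + (κ' + κ))) ρ₂ Nw) / (1 - Real.exp 1 * (αW' + αW + (αW' + αW)) * normV ((SpaceTimeIdx Lf M × SectorLeg N) × Fin 2) (κ' + κ + (κ' + κ + (κ' + κ))) ρ₂ Nw / (κ' + κ + (κ' + κ + (κ' + κ))) ^ 2)) *
                (ρ₂⁻¹ ^ (b + 1) * (Real.exp 1 * normV ((SpaceTimeIdx Lf M × SectorLeg N) × Fin 2) (κ' + κ + (κ' + κ + (κ' + κ))) ρ₂ Nw) / (1 - Real.exp 1 * (αW' + αW + (αW' + αW)) * normV ((SpaceTimeIdx Lf M × SectorLeg N) × Fin 2) (κ' + κ + (κ' + κ + (κ' + κ))) ρ₂ Nw / (κ' + κ + (κ' + κ + (κ' + κ))) ^ 2))) else 0)) * (αW' / (1 + Λ * ((R : ℝ) + 1))) +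
        ((((n + 1 + 1) * (n + 1 + 2) : ℕ) : ℝ) / 2 * (αW' + αW) *
              (ρf⁻¹ ^ (n + 3) * (Real.exp 1 * normV ((SpaceTimeIdx Lf M × SectorLeg N) × Fin 2) (κ' + κ) ρf Nw) / (1 - Real.exp 1 * (αW' + αW + (αW' + αW)) * normV ((SpaceTimeIdx Lf M × SectorLeg N) × Fin 2) (κ' + κ) ρf Nw / (κ' + κ) ^ 2)) +
            ‖(2 : ℂ)⁻¹‖ * ∑ a ∈ range (n + 2), ∑ b ∈ range (n + 2),
              (if a + b = n + 1 then (((a + 1) * (b + 1) : ℕ) : ℝ) *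
                (2 * (αW' + αW) * (ρf⁻¹ ^ (a + 1) * (Real.exp 1 * normV ((SpaceTimeIdx Lf M × SectorLeg N) × Fin 2) (κ' + κ) ρf Nw) / (1 - Real.exp 1 * (αW' + αW + (αW' + αW)) * normV ((SpaceTimeIdx Lf M × SectorLeg N) × Fin 2) (κ' + κ) ρf Nw / (κ' + κ) ^ 2)) *
                  (ρf⁻¹ ^ (b + 1) * (Real.exp 1 * normV ((SpaceTimeIdx Lf M × SectorLeg N) × Fin 2) (κ' + κ) ρf Nw) / (1 - Real.exp 1 * (αW' + αW + (αW' + αW)) * normV ((SpaceTimeIdx Lf M × SectorLeg N) × Fin 2) (κ' + κ) ρf Nw / (κ' + κ) ^ 2))) else 0)) * (Λ * ((R' : ℝ) + 1))⁻¹ := by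
  classical
  have hΛ0 : 0 ≤ Λ := hΛ.le
  -- residue distance ≤ fine distance (`L ∣ L″`)
  have hres : ∀ x' y' : TorusSite 2 Lf, (Torus.tnorm ((fun i => (((x' i).val : ℕ) : ZMod L)) - fun i => (((y' i).val : ℕ) : ZMod L)) : ℝ) ≤
      (Torus.tnorm (x' - y') : ℝ) := fun x' y' => by exact_mod_cast tnorm_residue_sub_le hLf x' y'
  -- §A covariance data: entries, plain rows, moments, residue-weighted rows, far tails
  have hwt1 : ∀ X Y : SpaceTimeIdx L M × SectorLeg N, (1 : ℝ) ≤ 1 + Λ * (Torus.tnorm (X.1.2 - Y.1.2) : ℝ) := fun X Y => by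
    nlinarith [(Nat.cast_nonneg (Torus.tnorm (X.1.2 - Y.1.2)) : (0:ℝ) ≤ _)]
  have hwt1' : ∀ X' Y' : SpaceTimeIdx Lf M × SectorLeg N, (1 : ℝ) ≤ 1 + Λ * (Torus.tnorm (X'.1.2 - Y'.1.2) : ℝ) := fun X' Y' => by
    nlinarith [(Nat.cast_nonneg (Torus.tnorm (X'.1.2 - Y'.1.2)) : (0:ℝ) ≤ _)]
  have hs : ∀ X Y, ‖CL X Y‖ ≤ αW := fun X Y => norm_le_of_scaledRow CL _ hwt1 X Y (hrowW X)
  have hs' : ∀ X' Y', ‖CLf X' Y'‖ ≤ αW' := fun X' Y' => norm_le_of_scaledRow CLf _ hwt1' X' Y' (hrowW' X')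
  have hrow : ∀ X, ∑ Y, ‖CL X Y‖ ≤ αW := fun X => sum_norm_le_of_scaledRow CL _ hwt1 X (hrowW X)
  have hrow' : ∀ X', ∑ Y', ‖CLf X' Y'‖ ≤ αW' := fun X' => sum_norm_le_of_scaledRow CLf _ hwt1' X' (hrowW' X')
  have hm1 : ∀ X, ∑ Y, ‖CL X Y‖ * (Λ * (Torus.tnorm (X.1.2 - Y.1.2) : ℝ)) ≤ αW :=
    fun X => sum_norm_mul_le_of_scaledRow CL (fun X Y => Λ * (Torus.tnorm (X.1.2 - Y.1.2) : ℝ)) X (hrowW X)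
  have hm1' : ∀ X', ∑ Y', ‖CLf X' Y'‖ *
      (Λ * (Torus.tnorm ((fun i => (((X'.1.2 i).val : ℕ) : ZMod L)) - fun i => (((Y'.1.2 i).val : ℕ) : ZMod L)) : ℝ)) ≤ αW' := by
    intro X'
    refine le_trans (sum_le_sum fun Y' _ => mul_le_mul_of_nonneg_left (mul_le_mul_of_nonneg_left (hres X'.1.2 Y'.1.2) hΛ0) (norm_nonneg _)) ?_
    exact sum_norm_mul_le_of_scaledRow CLf (fun X' Y' => Λ * (Torus.tnorm (X'.1.2 - Y'.1.2) : ℝ)) X' (hrowW' X')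
  have hroww : ∀ X', ∑ Y', ‖CLf X' Y'‖ *
      (1 + Λ * (Torus.tnorm ((fun i => (((X'.1.2 i).val : ℕ) : ZMod L)) - fun i => (((Y'.1.2 i).val : ℕ) : ZMod L)) : ℝ)) ≤ αW' := fun X' =>
    sum_mul_le_of_sum_mul_le_of_le univ (fun Y' => ‖CLf X' Y'‖) _ _ (fun _ _ => norm_nonneg _)
      (fun Y' _ => by nlinarith [hres X'.1.2 Y'.1.2]) (hrowW' X')
  have hcolw : ∀ Y', ∑ X', ‖CLf X' Y'‖ *
      (1 + Λ * (Torus.tnorm ((fun i => (((X'.1.2 i).val : ℕ) : ZMod L)) - fun i => (((Y'.1.2 i).val : ℕ) : ZMod L)) : ℝ)) ≤ αW' := fun Y' =>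
    sum_mul_le_of_sum_mul_le_of_le univ (fun X' => ‖CLf X' Y'‖) _ _ (fun _ _ => norm_nonneg _)
      (fun X' _ => by nlinarith [hres X'.1.2 Y'.1.2]) (hcolW' Y')
  have hT0 : 0 < αW' / (1 + Λ * ((R : ℝ) + 1)) := by positivity
  have hT : ∀ X', ∑ Y' ∈ univ.filter (fun Y' : (SpaceTimeIdx Lf M × SectorLeg N) => R < Torus.tnorm (X'.1.2 - Y'.1.2)), ‖CLf X' Y'‖ ≤
      αW' / (1 + Λ * ((R : ℝ) + 1)) := fun X' => sum_far_norm_le_of_scaledRow (fun Y : SpaceTimeIdx Lf M × SectorLeg N => Y.1.2) CLf hΛ0 R X' (hrowW' X')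
  have hTe : ∀ X' Y' : (SpaceTimeIdx Lf M × SectorLeg N),
      ∑ Y'' ∈ univ.filter (fun Y'' : (SpaceTimeIdx Lf M × SectorLeg N) => (e Y'').2 = (e Y').2 ∧ R < Torus.tnorm (X'.1.2 - Y''.1.2)), ‖CLf X' Y''‖ ≤
        αW' / (1 + Λ * ((R : ℝ) + 1)) := fun X' Y' =>
    sum_filter_and_far_norm_le CLf (fun Y'' : (SpaceTimeIdx Lf M × SectorLeg N) => R < Torus.tnorm (X'.1.2 - Y''.1.2))
      (fun Y'' => (e Y'').2 = (e Y').2) X' (hT X')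
  -- §B the nine transfer data of `T⁺_{L″}` (`aT := cW`, `τT := cW/(1+Λ_T(r+1))`)
  haveI : NeZero b := ⟨by rintro rfl; exact (NeZero.ne Lf) (by rw [hLf, zero_mul])⟩
  have hed1 : ∀ (x : ((SpaceTimeIdx Lf M × SectorLeg N) × Fin 2)) i, (((ed x).1 i : ℕ)) = (x.1.1.2 i).val / L := fun x i => by obtain ⟨x, s⟩ := x; rw [hed]; exact he1 x i
  have hed₁1 : ∀ (y' : ((SpaceTimeIdx Lf M × SectorLeg N₁) × Fin 2)) i, (((ed₁ y').1 i : ℕ)) = (y'.1.1.2 i).val / L := fun y' i => by obtain ⟨y, s⟩ := y'; rw [hed₁]; exact he₁1 y i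
  have hed2s : ∀ x : ((SpaceTimeIdx Lf M × SectorLeg N) × Fin 2), (fun Y : ((SpaceTimeIdx L M × SectorLeg N) × Fin 2) => Y.1.1.2) (ed x).2 = fun i => ((((x.1.1.2 i).val : ℕ)) : ZMod L) := fun x => by
    obtain ⟨x, s⟩ := x; rw [hed]; dsimp only; rw [he2]
  have hed₁2s : ∀ y' : ((SpaceTimeIdx Lf M × SectorLeg N₁) × Fin 2), (fun Y : ((SpaceTimeIdx L M × SectorLeg N₁) × Fin 2) => Y.1.1.2) (ed₁ y').2 = fun i => ((((y'.1.1.2 i).val : ℕ)) : ZMod L) := fun y' => by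
    obtain ⟨y, s⟩ := y'; rw [hed₁]; dsimp only; rw [he₁2]
  have hτT : 0 ≤ cW / (1 + ΛT * ((r : ℝ) + 1)) := by positivity
  have hTcol := transfer_col_le (fun x : ((SpaceTimeIdx Lf M × SectorLeg N) × Fin 2) => x.1.1.2) (fun y' : ((SpaceTimeIdx Lf M × SectorLeg N₁) × Fin 2) => y'.1.1.2) Tpf hΛT hcolT
  have hTwin := transfer_win_le (fun x : ((SpaceTimeIdx Lf M × SectorLeg N) × Fin 2) => x.1.1.2) (fun y' : ((SpaceTimeIdx Lf M × SectorLeg N₁) × Fin 2) => y'.1.1.2) Tpf hΛT hcolT ed ed₁ hcovT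
  have hTρ := transfer_rho_le (fun x : ((SpaceTimeIdx Lf M × SectorLeg N) × Fin 2) => x.1.1.2) (fun y' : ((SpaceTimeIdx Lf M × SectorLeg N₁) × Fin 2) => y'.1.1.2) Tpf hΛT hrowT ed ed₁
  have hTrowF := transfer_rowF_le (fun x : ((SpaceTimeIdx Lf M × SectorLeg N) × Fin 2) => x.1.1.2) (fun y' : ((SpaceTimeIdx Lf M × SectorLeg N₁) × Fin 2) => y'.1.1.2) Tpf hΛT hrowT RF
  have hTτF := transfer_tauF_le (fun x : ((SpaceTimeIdx Lf M × SectorLeg N) × Fin 2) => x.1.1.2) (fun y' : ((SpaceTimeIdx Lf M × SectorLeg N₁) × Fin 2) => y'.1.1.2) Tpf hΛT hrowT hcW hrF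
  have hTτ2 := transfer_tau2_le (fun x : ((SpaceTimeIdx Lf M × SectorLeg N) × Fin 2) => x.1.1.2) (fun y' : ((SpaceTimeIdx Lf M × SectorLeg N₁) × Fin 2) => y'.1.1.2) Tpf hΛT hrowT hcW hLf ed ed₁ hed1 hed₁1
    (le_trans (Nat.le_add_right r RZ) hrZR)
  have hTτ3 := transfer_tau3_le (fun x : ((SpaceTimeIdx Lf M × SectorLeg N) × Fin 2) => x.1.1.2) (fun y' : ((SpaceTimeIdx Lf M × SectorLeg N₁) × Fin 2) => y'.1.1.2) Tpf hΛT hrowT hcW hLf ed ed₁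
    (fun Y : ((SpaceTimeIdx L M × SectorLeg N) × Fin 2) => Y.1.1.2) (fun Y : ((SpaceTimeIdx L M × SectorLeg N₁) × Fin 2) => Y.1.1.2) hed2s hed₁2s hrN
  have hTτ1 := transfer_tau1_le (fun x : ((SpaceTimeIdx Lf M × SectorLeg N) × Fin 2) => x.1.1.2) (fun y' : ((SpaceTimeIdx Lf M × SectorLeg N₁) × Fin 2) => y'.1.1.2) Tpf hΛT hcolT hLf ed ed₁ hed1 hed₁1
    (fun Y : ((SpaceTimeIdx L M × SectorLeg N) × Fin 2) => Y.1.1.2) (fun Y : ((SpaceTimeIdx L M × SectorLeg N₁) × Fin 2) => Y.1.1.2) hed2s hed₁2s hrZR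
  have hTτ4 := transfer_tau4_le (fun x : ((SpaceTimeIdx Lf M × SectorLeg N) × Fin 2) => x.1.1.2) (fun y' : ((SpaceTimeIdx Lf M × SectorLeg N₁) × Fin 2) => y'.1.1.2) Tpf hΛT hcolT hLf ed ed₁ hed1 hed₁1
    (fun Y : ((SpaceTimeIdx L M × SectorLeg N) × Fin 2) => Y.1.1.2) (fun Y : ((SpaceTimeIdx L M × SectorLeg N₁) × Fin 2) => Y.1.1.2) hed2s hed₁2s hcovT hrZR
  -- §C profiles of the coarse previous action: plain, far
  have hNj : ∀ (k : ℕ) (p : Fin k) (y : ((SpaceTimeIdx L M × SectorLeg N₁) × Fin 2)), ∑ Y ∈ univ.filter (fun Y : Fin k → ((SpaceTimeIdx L M × SectorLeg N₁) × Fin 2) => Y p = y), ‖kernel ℂ 𝒲 k Y‖ ≤ N𝒲 k :=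
    fun k p y => sum_filter_norm_kernel_le_of_weighted 𝒲 k p y _ (fun Y => by
      have := labelDiam_nonneg (fun Y₁ Y₂ : ((SpaceTimeIdx L M × SectorLeg N₁) × Fin 2) => Λ₁ * (Torus.tnorm (Y₁.1.1.2 - Y₂.1.1.2) : ℝ)) (univ.image Y); linarith) (hN𝒲 k p y)
  have hNfarj : ∀ (k : ℕ) (p : Fin k) (y : ((SpaceTimeIdx L M × SectorLeg N₁) × Fin 2)) (i : Fin k),
      ∑ Y ∈ univ.filter (fun Y : Fin k → ((SpaceTimeIdx L M × SectorLeg N₁) × Fin 2) => Y p = y ∧ RZ - RN < Torus.tnorm ((Y p).1.1.2 - (Y i).1.1.2)), ‖kernel ℂ 𝒲 k Y‖ ≤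
        (1 + Λ₁ * (((RZ - RN : ℕ) : ℝ) + 1))⁻¹ * N𝒲 k :=
    fun k p y i => sum_far_norm_kernel_le_of_scaledWeighted (fun Y : ((SpaceTimeIdx L M × SectorLeg N₁) × Fin 2) => Y.1.1.2) 𝒲 hΛ₁ k p y i (RZ - RN) (hN𝒲 k p y)
  -- §D the coarse OUTPUT weighted profile and the coarse unit partition function by ONE weighted determinant-bounded step
  set dc : ((SpaceTimeIdx L M × SectorLeg N) × Fin 2) → ((SpaceTimeIdx L M × SectorLeg N) × Fin 2) → ℝ := fun Y₁ Y₂ => Λ * (Torus.tnorm (Y₁.1.1.2 - Y₂.1.1.2) : ℝ) with hdc_def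
  have hdc : IsLabelDist dc := isLabelDist_mul_of_nonneg hΛ0 (isLabelDist_tnorm_sectorSite.comap (fun Y : ((SpaceTimeIdx L M × SectorLeg N) × Fin 2) => Y.1))
  have hwt : IsTreeWeight (diamWeight (fun t : ℝ => 1 + t) dc) :=
    isTreeWeight_diamWeight hdc (fun s hs => by linarith) (fun s t _ hst => by linarith) (fun s t hs ht => by nlinarith)
  have hGBd : IsGramBoundedR Cd κ := isGramBoundedR_spectator CL Cd hCd hGB
  have hVe : ExteriorAlgebra.map (Matrix.toLin' Tpc) 𝒲 ∈ evenPart ℂ ((SpaceTimeIdx L M × SectorLeg N) × Fin 2) := (mem_evenPart_iff).2 (map_mem_evenOdd_zero ℂ (Matrix.toLin' Tpc) h𝒲e)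
  have hV0 : constPart ℂ (ExteriorAlgebra.map (Matrix.toLin' Tpc) 𝒲) = 0 := by rw [constPart_map, h𝒲0]
  have hpair : ∀ X Y : ((SpaceTimeIdx L M × SectorLeg N) × Fin 2), diamWeight (fun t : ℝ => 1 + t) dc {X, Y} = 1 + Λ * (Torus.tnorm (X.1.1.2 - Y.1.1.2) : ℝ) :=
    fun X Y => by rw [diamWeight_pair hdc]
  have hrowd : ∀ X, ∑ Y, ‖Cd X Y‖ * diamWeight (fun t : ℝ => 1 + t) dc {X, Y} ≤ αW := by
    intro X; simp only [hpair]
    exact sum_norm_spectatorCov_mul_row_le CL Cd hCd (fun Y : ((SpaceTimeIdx L M × SectorLeg N) × Fin 2) => 1 + Λ * (Torus.tnorm (X.1.1.2 - Y.1.1.2) : ℝ)) X hαW.le (hrowW X.1)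
  have hcold : ∀ Y, ∑ X, ‖Cd X Y‖ * diamWeight (fun t : ℝ => 1 + t) dc {X, Y} ≤ αW := by
    intro Y; simp only [hpair]
    exact sum_norm_spectatorCov_mul_col_le CL Cd hCd (fun X : ((SpaceTimeIdx L M × SectorLeg N) × Fin 2) => 1 + Λ * (Torus.tnorm (X.1.1.2 - Y.1.1.2) : ℝ)) Y hαW.le (hcolW Y.1)
  have hNVd : ∀ m' (j : Fin (2 * m')) (x : ((SpaceTimeIdx L M × SectorLeg N) × Fin 2)), ∑ Y ∈ univ.filter (fun Y : Fin (2 * m') → ((SpaceTimeIdx L M × SectorLeg N) × Fin 2) => Y j = x),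
      ‖kernel ℂ (ExteriorAlgebra.map (Matrix.toLin' Tpc) 𝒲) (2 * m') Y‖ * diamWeight (fun t : ℝ => 1 + t) dc (univ.image Y) ≤ NV m' :=
    fun m' j x => hNV m' j x
  obtain ⟨hZ, hstep⟩ := sum_wt_norm_kernel_effAction_le_of_gramBounded (C := Cd) hwt hκ hGBd _ hVe hV0 NV hNV0 hNVd hαW hrowd hcold hρ₀ hθ₀
  have hθ₀' : 0 < 1 - Real.exp 1 * αW * normV ((SpaceTimeIdx L M × SectorLeg N) × Fin 2) κ ρ₀ NV / κ ^ 2 := sub_pos.2 hθ₀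
  have hNw0 : ∀ m', 0 ≤ Nw m' := fun m' => by
    rw [hNwdef]; exact div_nonneg (mul_nonneg (pow_nonneg (inv_nonneg.2 hρ₀.le) _) (mul_nonneg (Real.exp_pos 1).le (normV_nonneg hκ.le hρ₀.le hNV0))) hθ₀'.le
  have hNw : ∀ (m' : ℕ) (j : Fin (2 * m')) (x : ((SpaceTimeIdx L M × SectorLeg N) × Fin 2)), ∑ Y ∈ univ.filter (fun Y : Fin (2 * m') → ((SpaceTimeIdx L M × SectorLeg N) × Fin 2) => Y j = x),
      ‖kernel ℂ (effAction ℂ Cd (ExteriorAlgebra.map (Matrix.toLin' Tpc) 𝒲)) (2 * m') Y‖ * (1 + labelDiam dc (univ.image Y)) ≤ Nw m' := by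
    intro m' j x
    rcases Nat.eq_zero_or_pos m' with h0 | hpos
    · subst h0; exact absurd j.2 (by omega)
    · rw [hNwdef]
      refine le_trans (le_of_eq (sum_congr rfl fun Y _ => mul_comm _ _)) (hstep (by omega) j x)
  -- the fine input profile in the residue-distance weight (residue distance ≤ fine distance)
  have hNW'r : ∀ m' (j : Fin (2 * m')) (x : ((SpaceTimeIdx Lf M × SectorLeg N) × Fin 2)),
      ∑ Y ∈ univ.filter (fun Y : Fin (2 * m') → ((SpaceTimeIdx Lf M × SectorLeg N) × Fin 2) => Y j = x),
        ‖kernel ℂ (ExteriorAlgebra.map (Matrix.toLin' Tpf) 𝒲') (2 * m') Y‖ *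
          (1 + labelDiam (fun Y₁ Y₂ : ((SpaceTimeIdx Lf M × SectorLeg N) × Fin 2) =>
            Λ * (Torus.tnorm ((fun i => (((Y₁.1.1.2 i).val : ℕ) : ZMod L)) - fun i => (((Y₂.1.1.2 i).val : ℕ) : ZMod L)) : ℝ)) (univ.image Y)) ≤ NW' m' := by
    intro m' j x
    refine le_trans (sum_le_sum fun Y _ => mul_le_mul_of_nonneg_left (add_le_add_right ?_ 1) (norm_nonneg _)) (hNW' m' j x)
    refine labelDiam_le _ (labelDiam_nonneg _ _) fun a ha b' hb => ?_
    exact (mul_le_mul_of_nonneg_left (hres a.1.1.2 b'.1.1.2) hΛ0).trans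
      (le_labelDiam (fun Y₁ Y₂ : ((SpaceTimeIdx Lf M × SectorLeg N) × Fin 2) => Λ * (Torus.tnorm (Y₁.1.1.2 - Y₂.1.1.2) : ℝ)) ha hb)
  -- §E assemble M3d-wt
  exact srcSector_sum_norm_kernel_twoVolume_scaleSucc_wt_le hLf hβ hΛ e he1 he2 ed hed e₁ he₁2 ed₁ hed₁ 𝔣t Φ FtL FtLf hFtL hFtLf pL pLf hpL hpLf
    CL hCL CLf hCLf Cd hCd Cd' hCd' 𝔣' 𝔣₁ F'L F'Lf hF'L hF'Lf F₁L F₁Lf hF₁L hF₁Lf Tc hTc Tf hTf Jc Jf hPJ Tpc hTpc Tpf hTpf R R' w hw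
    hT0 hT hTe hαW.le hαW'.le hs hs' (add_pos hαW' hαW) hrow hrow' hαW.le hαW'.le hm1 hm1' hκ hκ' hGB hGB' hαW' hroww hcolw
    𝒲 h𝒲e h𝒲0 𝒲' h𝒲'e h𝒲'0 hZ Nw hNw0 hNw hρf hθw hρ₂ hθ₂ NV NW' hNV0 hNW'0 hNV hNW'r RN RZ RF hNZ hcW hτT
    hTcol hTwin (fun x hx => hTρ x) (fun x hx => hTrowF x) (fun x hx => hTτF x) (fun x hx y hy => hTτ1 x hx y hy) (fun x hx => hTτ2 x hx)
    (fun x hx => hTτ3 x) (fun x hx y hy => hTτ4 x hx y hy)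
    N𝒲 (fun k => (1 + Λ₁ * (((RZ - RN : ℕ) : ℝ) + 1))⁻¹ * N𝒲 k) Ej NDj hN𝒲0 (fun k => mul_nonneg (inv_nonneg.2 (by positivity)) (hN𝒲0 k)) hEj0 hNDj0
    hNj hNfarj hEj hNDj Ein hEin0 hEin hρ' hνE hbar hθ₂' n p
end Summit.HubbardSuperconductivity.HubbardSuperconductivity.Theorems.TwoVolumeDefect

end
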